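import Literature.MathematicalPhysics.QuantumFieldTheory.Balaban1983to89.B12Lineariz267
import Literature.MathematicalPhysics.QuantumFieldTheory.Balaban1983to89.B11Eq63FunctionalDerivative
import Literature.MathematicalPhysics.QuantumFieldTheory.Balaban1983to89.B11Prop6Scheme

/-!
# `Balaban1983to89.B11Prop3Model` — T. Bałaban, *The variational problem and background fields in renormalization group
# method for lattice gauge theories*, Commun. Math. Phys. **102** (1985) 277–309 [Balaban1985Variational], **Proposition 3**
# (Sect. C, p. 289): the typed statement of record `B11.Prop3Printed C₁ B₃ C₂ C₃ B₀ c1h c₄ δ₀ fam` INHABITED BY NAME for the model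
# family of the Sect. C contraction scheme (kind «model-instance»: one complex Banach space of configurations A′ per index with
# the norm of (43); the three cited inputs of the printed proof — (44) «Proposition 4 of [4]», (46) «Theorem 3.12 from [5]»,
# (72) «Proposition 5 of [4]» — are the model's reading of the hypothesis (14) at the background U₀; (73) READ AT NORM LEVEL)

statement-level skeleton of published theorems with citation tags; proofs where landed; nothing here is a claim
about the Yang–Mills mass gap

PDF held: `paper:balaban1985-cmp102-variational-background` (journal page = PDF page + 276); Sect. C pp. 285–289 (PDF 9–13) read from
the held text by this seat (2026-08-21; renders of pp. 285–289 were read as images by the b13/r08 lineages whose modules are used).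

WHAT IS REPRODUCED.  SKELETON row `B11.Prop3` (reader r08 `ROWS-B11.md`; decl of record `B11.Prop3Printed`, B11.lean, typed-existing
over the abstract Landau-gauge carrier `B11.LGData`, «existence/analyticity/range parts proved abstractly» = rows `B11.Eq47`, `B11.Eq51`,
`B11.Eq57`, `B11.Eq59`).  THE PRINTED TEXT (p. 289 [PDF 13], verbatim): *"Let us gather the results of this section in Proposition 3.
The transformation (47) satisfying the identity (48), i.e. linearizing the averaging operation Q(ηA), is defined and analytic for A′
satisfying (43) with ε₃ sufficiently small (e.g. 18C₂B₀dc₁(½)ε₃ ≤ 1, 2ε₃ ≤ c₄). The range of this transformation contains the set (43)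
with ε₂ ≤ ¼ε₃, and is contained in the corresponding set with 2ε₃ instead of ε₂. The function D(A′) satisfies the bound (55) and its
functional derivative satisfies the bound (73)."*  With (47) *"A = A′ − HD(A′)"*, (49) *"C_j(L^jηA′ − L^jηHD(A′)) = D(A′) on Λ_j"*, (55)
*"|D(A′)| ≤ … ≤ 4C₂|A′|²_{(−1)}"*, (73) *"|𝔇(A′; c, b)| ≤ O(1)C₃ε₃(L^jη)^{−d+1}e^{−½δ₀d(c₋,y)}"*, and the three inputs (44) *"The
Proposition 4 of [4] implies … |C_j(L^jηA)| ≤ C₂(L^jη)²|A|²"*, (46) *"the Theorem 3.12 from [5] implies |HB| ≤ B₀(L^jη)^{−1}|B|,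
|∇HB| ≤ B₀(L^jη)^{−2}|B|"*, (72) *"Proposition 5 of [4] implies that |L^jη(δ/δA)C(L^jη(A′ − HD(A′)))| ≤ L^jη(L^jη)^{−d}C₃2ε₃"*.

THE PRINTED PROOF, AND WHERE IT IS IN THE TREE.  (49)–(54): the fixed point of X ↦ C_j(L^jηA′ − L^jηHX) by the contraction mapping
theorem with the Cauchy-formula Lipschitz estimate (54) «9C₂B₀ε₃ < 1; … ε₃ ≤ (18C₂B₀)⁻¹» — `B13Contraction113` (unit b2b-balaban-b13-g5:
`mapsTo_T`, `lipschitz_T`, `exists_unique_fixedPoint`, (55) = `bound_114`, `analytic_fixedPoint_113`); (57)–(62): the range statements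
by the explicit inverse A ↦ A + HC_j(L^jηA) — `B12Lineariz267` (unit adv9 lineage, dictionary L^jη ↦ 1: `mapsTo_phi` = (57)–(58),
`phi_psi_of_norm_lt` / `ball_half_subset_image_phi` = (59)–(62), `norm_Dt_le` = (55), `differentiableOn_Dt_line` = «an analytic function
of A′», `smallness_of_le` = «18C₂B₀ε₃ ≤ 1 ⇒ 9C₂B₀ε₃ < 1»); (63)–(70): existence of the functional derivative 𝔇 = (δ/δA′)D and the
formula (70) 𝔇 = (I + ℜ)⁻¹𝒞′ by the implicit function theorem, (69) the Cauchy bound ‖ℜ‖ ≤ 9C₂B₀ε₃ — `B11Eq63FunctionalDerivative`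
(this lineage, gen 3: `continuousAt_of_eq49`, `eq70_neumann`, `ineq69`, `eq69_line1`).  Until now nothing connected these to the typed
statement `B11.Prop3Printed`.  THIS FILE: §1 the solution D(A′) of (49) as a FUNCTION (`Dfix`, an ε-free selector — the fixed point with
‖X‖ ≤ 4C₂‖A′‖², which is THE fixed point of every admissible ball by (55) and uniqueness: `Dfix_spec`, `Dfix_ball`, `Dfix_fix`); §2 the
norm-level (73): **`norm_fderiv_Dfix_le`** ‖(δ/δA′)D(A′)‖ ≤ 4C₃ε₃ from (69)–(72) («The formula (70) and the inequalities (71), (72) give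
finally (73)» with the Neumann bound ‖(I + ℜ)⁻¹‖ ≤ 2 for (71)); §3 the model family (`Inputs`, `LinDatum`, `LinDatum.toLGData`); §4
**`prop3Printed_model : B11.Prop3Printed C₁ B₃ C₂ C₃ B₀ c1h c₄ δ₀ (fun i => (δ i).toLGData (Bdryf i) C₂ C₃ B₀ c₄)`** for EVERY family δ
(one O(1) = 4 before the index).

MODEL / DECLARED READINGS (DIVERGENCE D-B11-20 style; each a field of `LinDatum.toLGData`).
 (M1) ONE NORM: per index the 𝔤ᶜ-valued configurations A′ on Ω₀ form a complex Banach space `𝒴 i` whose norm stands for the (43)-norm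
      max{sup_j L^jη|A′|_{Ω_j}, sup_j (L^jη)²|∇A′|_{Ω_j}} (`In43 U₀ ε A := ‖A‖ < ε`) AND for |·|_{(−1)} (`nM1 := ‖·‖`; so the model's (55)
      «≤ 4C₂‖A′‖²» is (55) with the larger norm on the right — implied by, weaker than, print); the values D(A′), X on 𝔅_k form a complex
      Banach space `𝒳 i`; H = `hop U₀ : 𝒳 →ₗ 𝒴`, A ↦ C_j(L^jηA) = `Ct U₀ : 𝒴 → 𝒳` are data depending on the background U₀ : `Cfg i`.
 (M2) HYPOTHESIS (14) is read as the three cited inputs AT U₀ that Sect. C draws from it (`Sat14 _ _ _ U₀ := Inputs (Ct U₀) (hop U₀) C₂ C₃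
      B₀ c₄`): (46) ‖HX‖ ≤ B₀‖X‖ ([5] Thm 3.12, `B9.Thm312Printed`, a citation statement), (44) ‖C(Y)‖ ≤ C₂‖Y‖² with C¹-regularity on the
      ball ‖Y‖ < 2c₄ ([4] Prop. 4, complex form Prop. 7, `B7.Prop4Printed`/`Prop7Printed`; GAPS G-B11-C1), (72) ‖(δ/δA)C(Y)‖ ≤ C₃‖Y‖ there
      ([4] Prop. 5 (157), `B7.Prop5Printed`).  The parameters (C₁B₃ε₁, C₁ε₁) of (14) play no role in Prop. 3 and are ignored.
 (M3) RADIUS: print asks «2ε₃ ≤ c₄ (see Proposition 4 in [4])» for the arguments of C_j in (52), but the Cauchy circles of (53)/(69) reach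
      arguments of norm 3ε₃ (GAPS G-B11-C1: «for COMPLEX arguments of size ≤ 3ε₃»; `B13Contraction113` asks 3ε ≤ R): the model carries
      [4] Props 4/5/7 on the radius 2c₄, so that 2ε₃ ≤ c₄ gives 3ε₃ < 2c₄.
 (M4) SMALLNESS: print's «18C₂B₀dc₁(½)ε₃ ≤ 1» implies the norm-level «ε₃ ≤ (18C₂B₀)⁻¹» of p. 286 because d·c₁(½) ≥ 1 (d ≥ 1 a datum field;
      c₁(½) ≥ 1 — the scale sum of Lemma 2.1 [3] contains its diagonal term — a hypothesis of the theorem).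
 (M5) «DEFINED AND ANALYTIC» (`Def47 U₀ ε`): the defining equation (49) holds on ‖A′‖ < ε for the selected D, and A′ ↦ A′ − HD(A′) is
      holomorphic along every complex line inside ‖·‖ < ε (the lineage's notion, `B12Lineariz267` §3; joint analyticity not typed).
 (M6) (73) AT NORM LEVEL — the one substantive degeneration: the model has NO block geometry (`Cell = Site = PUnit`, `scale = 0`, `dist =
      0`, `eta = 1`), `kerD U₀ A′ _ _ := ‖(δ/δA′)D(A′)‖` (operator norm of the Fréchet derivative), and (73) becomes ‖𝔇(A′)‖ ≤ O(1)C₃ε₃ with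
      O(1) = 4 — what (70), ‖(I + ℜ)⁻¹‖ ≤ 2 ((71) at norm level, from (69) ‖ℜ‖ ≤ 9C₂B₀ε₃ ≤ ½) and (72) give WITHOUT the locality of the
      kernels; the DECAY e^{−½δ₀d(c₋,y)} and the factor (L^jη)^{−d+1} of (73) are the kernel-majorant derivation `B11Eq73KernelDecay.ineq73`
      (r08 gen 3, Lemma 2.1 [3] as `RowSum`), NOT connected to this model.
 (M7) INERT FIELDS: `In18`, `Crit`, `In19_21`, `CritL`, `Restricted`, `toAxial`, the Sect. D–E fields (`dVn`, `dVAnalytic`, `Sol111`,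
      `T112`, `LikeH1B`, `Sol111G`, `SolAnalytic`), `Bdry`, `Pert`, `GT` carry no claim (Prop. 6's model is the sibling `B11Prop6Model`).
HONEST SCOPE.  Inhabits the typed Proposition 3 for the scheme's model family, (73) at norm level only; constructs neither C_j(U₀, ·) nor
H(U₀) on Bałaban's lattice and proves nothing of [4] Props 4/5/7 or [5] Thm 3.12 (INTERFACES §3 NE9 letters (L4)/(L5), socket C19′ —
frozen under ruling e34b3e0c (0)).  Mega-formalization `lit-balaban`, HOME `run/shared/lean/pub/lit-balaban/`, reader/typer seat r08 gen 6
(unit `lit-balaban-r08`).  Imports `B12Lineariz267`, `B11Eq63FunctionalDerivative`, `B11Prop6Scheme` (for `B11` and `Prop4Hyp`);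
modifies nothing.  Net new unproved facts: 0.
-/

noncomputable section

open Metric Set Filter Topology

namespace Literature.MathematicalPhysics.QuantumFieldTheory.Balaban1983to89.B11Prop3Model

open B13Contraction113 (QuadAnalytic exists_unique_fixedPoint bound_114 lipschitz_T)
open B11Prop6Scheme (Prop4Hyp)

variable {𝒴 𝒳 : Type*} [NormedAddCommGroup 𝒴] [NormedSpace ℂ 𝒴] [NormedAddCommGroup 𝒳] [NormedSpace ℂ 𝒳]

/-! ## §1 The solution `D(A′)` of (49) as a function -/

/-- **D(A′), the solution of (49)** *"C_j(L^jηA′ − L^jηHD(A′)) = D(A′)"* (p. 285), AS A FUNCTION of A′: a fixed point X of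
`X ↦ Ct(A′ − hop X)` with `‖X‖ ≤ 4C₂‖A′‖²` selected by `Classical.epsilon` — by (55) and the uniqueness of p. 286 this is THE fixed
point of every admissible ball (`Dfix_spec`, `Dfix_ball`); an unspecified element where no such fixed point exists.
[cite: Balaban1985Variational, (49) p.285, (55) p.286] -/
def Dfix (Ct : 𝒴 → 𝒳) (hop : 𝒳 →ₗ[ℂ] 𝒴) (C₂ : ℝ) (A : 𝒴) : 𝒳 :=
  Classical.epsilon fun X : 𝒳 => ‖X‖ ≤ 4 * C₂ * ‖A‖ ^ 2 ∧ Ct (A - hop X) = X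

section DfixSpec

variable [CompleteSpace 𝒳] {Ct : 𝒴 → 𝒳} {hop : 𝒳 →ₗ[ℂ] 𝒴} {C₂ R b ε : ℝ}

/-- Under the contraction conditions of p. 286 (`9C₂bε < 1`, `3ε ≤ R`) and `‖A′‖ < ε`: `Dfix` solves (49) and obeys (55)
`‖D(A′)‖ ≤ 4C₂‖A′‖²` (existence: `B13Contraction113.exists_unique_fixedPoint` + `bound_114`). [cite: Balaban1985Variational, (49) p.285, (55) p.286] -/
theorem Dfix_spec (hC : QuadAnalytic Ct C₂ R) (hC₂ : 0 ≤ C₂) (hb : 0 ≤ b) (hHop : ∀ X, ‖hop X‖ ≤ b * ‖X‖)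
    (hq : 9 * C₂ * b * ε < 1) (hRC : 3 * ε ≤ R) {A : 𝒴} (hA : ‖A‖ < ε) :
    ‖Dfix Ct hop C₂ A‖ ≤ 4 * C₂ * ‖A‖ ^ 2 ∧ Ct (A - hop (Dfix Ct hop C₂ A)) = Dfix Ct hop C₂ A := by
  obtain ⟨X, hX, hfix, -⟩ := exists_unique_fixedPoint hC hC₂ hb hHop hA hq hRC
  exact Classical.epsilon_spec (p := fun X : 𝒳 => ‖X‖ ≤ 4 * C₂ * ‖A‖ ^ 2 ∧ Ct (A - hop X) = X)
    ⟨X, bound_114 hC hC₂ hb hHop hA hq hRC hX hfix, hfix⟩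

/-- `Dfix` lies in the ball `‖X‖ ≤ 4C₂ε²` of every admissible ε > ‖A′‖ (the hypothesis `hDball` of `B12Lineariz267`).
[cite: Balaban1985Variational, (51)–(52) p.285] -/
theorem Dfix_ball (hC : QuadAnalytic Ct C₂ R) (hC₂ : 0 ≤ C₂) (hb : 0 ≤ b) (hHop : ∀ X, ‖hop X‖ ≤ b * ‖X‖)
    (hq : 9 * C₂ * b * ε < 1) (hRC : 3 * ε ≤ R) :
    ∀ B : 𝒴, ‖B‖ < ε → Dfix Ct hop C₂ B ∈ closedBall (0:𝒳) (4 * C₂ * ε ^ 2) := by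
  intro B hB
  rw [mem_closedBall, dist_zero_right]
  refine (Dfix_spec hC hC₂ hb hHop hq hRC hB).1.trans ?_
  have h2 : ‖B‖ ^ 2 ≤ ε ^ 2 := pow_le_pow_left₀ (norm_nonneg B) hB.le 2
  exact mul_le_mul_of_nonneg_left h2 (by positivity)

/-- `Dfix` solves (49) on every admissible ball (the hypothesis `hDfix` of `B12Lineariz267`). [cite: Balaban1985Variational, (49) p.285] -/
theorem Dfix_fix (hC : QuadAnalytic Ct C₂ R) (hC₂ : 0 ≤ C₂) (hb : 0 ≤ b) (hHop : ∀ X, ‖hop X‖ ≤ b * ‖X‖)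
    (hq : 9 * C₂ * b * ε < 1) (hRC : 3 * ε ≤ R) :
    ∀ B : 𝒴, ‖B‖ < ε → Ct (B - hop (Dfix Ct hop C₂ B)) = Dfix Ct hop C₂ B :=
  fun _ hB => (Dfix_spec hC hC₂ hb hHop hq hRC hB).2

end DfixSpec

/-! ## §2 The three cited inputs of Sect. C, and (73) at norm level -/

/-- **The three inputs that Sect. C draws from the hypothesis (14) at the background U₀** (reading (M2)): (46) p. 285 *"the Theorem
3.12 from [5] implies |HB| ≤ B₀(L^jη)^{−1}|B|, |∇HB| ≤ B₀(L^jη)^{−2}|B|"* (`norm_H`); (44) p. 285 *"The Proposition 4 of [4] implies …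
|C_j(L^jηA)| ≤ C₂(L^jη)²|A|²"* for complex arguments with C¹-regularity («analytic», [4] Prop. 7) on the ball of radius 2c₄ (reading
(M3)) (`quad`, `contDiff`); (72) p. 289 *"Proposition 5 of [4] implies"* the derivative bound ‖(δ/δA)C(Y)‖ ≤ C₃‖Y‖ there (`deriv_le`).
A HYPOTHESIS structure: nothing of [4], [5] is asserted. [cite: Balaban1985Variational, (44)–(46) p.285, (72) p.289] -/
structure Inputs (Ct : 𝒴 → 𝒳) (hop : 𝒳 →ₗ[ℂ] 𝒴) (C₂ C₃ B₀ c₄ : ℝ) : Prop where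
  norm_H : ∀ X, ‖hop X‖ ≤ B₀ * ‖X‖
  quad : ∀ Y : 𝒴, ‖Y‖ < 2 * c₄ → ‖Ct Y‖ ≤ C₂ * ‖Y‖ ^ 2
  contDiff : ContDiffOn ℂ 1 Ct {Y : 𝒴 | ‖Y‖ < 2 * c₄}
  deriv_le : ∀ Y : 𝒴, ‖Y‖ < 2 * c₄ → ‖fderiv ℂ Ct Y‖ ≤ C₃ * ‖Y‖

namespace Inputs

variable {Ct : 𝒴 → 𝒳} {hop : 𝒳 →ₗ[ℂ] 𝒴} {C₂ C₃ B₀ c₄ : ℝ}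

/-- The inputs in the Fréchet form `Prop4Hyp` of the lineage (quadratic bound + holomorphy on the ball).
[cite: Balaban1985Variational, (44) p.285] -/
theorem prop4Hyp (h : Inputs Ct hop C₂ C₃ B₀ c₄) : Prop4Hyp Ct C₂ (2 * c₄) :=
  ⟨h.quad, h.contDiff.differentiableOn one_ne_zero⟩

/-- The inputs in the line-analytic form `QuadAnalytic` of `B13Contraction113`. [cite: Balaban1985Variational, (44) p.285] -/
theorem quadAnalytic (h : Inputs Ct hop C₂ C₃ B₀ c₄) : QuadAnalytic Ct C₂ (2 * c₄) :=
  h.prop4Hyp.quadAnalytic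

/-- H as a continuous linear map (bounded by (46)). [cite: Balaban1985Variational, (46) p.285] -/
def hopL (h : Inputs Ct hop C₂ C₃ B₀ c₄) : 𝒳 →L[ℂ] 𝒴 := hop.mkContinuous B₀ h.norm_H

/-- Unfolding of `hopL`: the continuous linear H acts as the H of (46). [cite: Balaban1985Variational, (46) p.285] -/
theorem hopL_apply (h : Inputs Ct hop C₂ C₃ B₀ c₄) (X : 𝒳) : h.hopL X = hop X := rfl

end Inputs

/-- The smallness arithmetic of Proposition 3: from the printed `18C₂B₀·d·c₁(½)·ε₃ ≤ 1` with d·c₁(½) ≥ 1 (reading (M4)) the norm-level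
`18C₂B₀ε₃ ≤ 1` of p. 286, hence «9C₂B₀ε₃ < 1» (contraction) and `4C₂B₀ε₃ ≤ 1` (self-map); from `2ε₃ ≤ c₄`, c₄ > 0: `3ε₃ ≤ 2c₄` and
`3ε₃ < 2c₄` (reading (M3)).  Real arithmetic. [cite: Balaban1985Variational, Prop. 3 p.289, (54) p.286] -/
theorem smallness {C₂ B₀ d c1h ε₃ c₄ : ℝ} (hC₂ : 0 ≤ C₂) (hB₀ : 0 ≤ B₀) (hε₃ : 0 ≤ ε₃) (hd : 1 ≤ d) (hc1h : 1 ≤ c1h)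
    (hc₄ : 0 < c₄) (h18 : 18 * C₂ * B₀ * d * c1h * ε₃ ≤ 1) (h2 : 2 * ε₃ ≤ c₄) :
    9 * C₂ * B₀ * ε₃ < 1 ∧ 4 * C₂ * B₀ * ε₃ ≤ 1 ∧ 3 * ε₃ ≤ 2 * c₄ ∧ 3 * ε₃ < 2 * c₄ := by
  have hdc : 1 ≤ d * c1h := by nlinarith
  have h0 : 0 ≤ 18 * C₂ * B₀ * ε₃ := by positivity
  have h18' : 18 * C₂ * B₀ * ε₃ ≤ 1 := by
    have : 18 * C₂ * B₀ * ε₃ * 1 ≤ 18 * C₂ * B₀ * ε₃ * (d * c1h) := mul_le_mul_of_nonneg_left hdc h0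
    nlinarith
  obtain ⟨hq, hR2⟩ := B12Lineariz267.smallness_of_le C₂ B₀ ε₃ h18'
  exact ⟨hq, hR2, by linarith, by linarith⟩

section NormLevel73

variable [CompleteSpace 𝒴] [CompleteSpace 𝒳] {Ct : 𝒴 → 𝒳} {hop : 𝒳 →ₗ[ℂ] 𝒴} {C₂ C₃ B₀ c₄ ε₃ : ℝ}

omit [CompleteSpace 𝒴] [CompleteSpace 𝒳] in
/-- **(69), operator form**: with `X₀ = A′ − HD(A′)`, `‖X₀‖ ≤ 2ε₃` ((57)), the operator `ℜ = 𝒞′H` of (68)–(70) (`𝒞′ = (δ/δA)C` at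
`X₀`) has norm `≤ 9C₂B₀ε₃` — the Cauchy step (69) column by column (`B11Eq63FunctionalDerivative.ineq69` with `M = B₀‖X‖`,
`eq69_line1`). [cite: Balaban1985Variational, (69) p.288] -/
theorem opNorm_R_le (hin : Inputs Ct hop C₂ C₃ B₀ c₄) (hC₂ : 0 ≤ C₂) (hB₀ : 0 ≤ B₀) (hε₃ : 0 < ε₃)
    (hR : 3 * ε₃ < 2 * c₄) {X₀ : 𝒴} (hX₀ : ‖X₀‖ ≤ 2 * ε₃) {𝒞' : 𝒴 →L[ℂ] 𝒳} (h𝒞 : HasFDerivAt Ct 𝒞' X₀) :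
    ‖𝒞' ∘L hin.hopL‖ ≤ 9 * C₂ * B₀ * ε₃ := by
  refine ContinuousLinearMap.opNorm_le_bound _ (by positivity) fun X => ?_
  rw [ContinuousLinearMap.comp_apply, hin.hopL_apply]
  by_cases hM : B₀ * ‖X‖ = 0
  · have h0 : hop X = 0 := by
      have : ‖hop X‖ ≤ 0 := (hin.norm_H X).trans hM.le
      exact norm_le_zero_iff.mp this
    rw [h0, map_zero, norm_zero]; positivity
  · have hMpos : 0 < B₀ * ‖X‖ := lt_of_le_of_ne (by positivity) (Ne.symm hM)
    have h69 := B11Eq63FunctionalDerivative.ineq69 hin.quadAnalytic hC₂ hε₃ hMpos hX₀ (hin.norm_H X) hR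
    rw [B11Eq63FunctionalDerivative.eq69_line1 h𝒞] at h69
    calc ‖𝒞' (hop X)‖ ≤ 9 * C₂ * ε₃ * (B₀ * ‖X‖) := h69
      _ = 9 * C₂ * B₀ * ε₃ * ‖X‖ := by ring

omit [CompleteSpace 𝒳] in
/-- The Neumann bound behind (71) at norm level: for `‖ℜ‖ < 1`, `‖Σₙ(−ℜ)ⁿ‖ ≤ (1 − ‖ℜ‖)⁻¹` (operators on a complete space; `‖I‖ ≤ 1`).
[cite: Balaban1985Variational, (71) p.289] -/
theorem norm_neumann_le (ℜ : 𝒳 →L[ℂ] 𝒳) (hℜ : ‖ℜ‖ < 1) : ‖∑' n : ℕ, (-ℜ) ^ n‖ ≤ (1 - ‖ℜ‖)⁻¹ := by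
  have hn : ‖-ℜ‖ < 1 := by rwa [norm_neg]
  have h := tsum_geometric_le_of_norm_lt_one (-ℜ) hn
  have h1 : ‖(1 : 𝒳 →L[ℂ] 𝒳)‖ ≤ 1 := by
    rw [ContinuousLinearMap.one_def]; exact ContinuousLinearMap.norm_id_le
  rw [norm_neg] at h
  linarith

/-- **(73) at norm level (reading (M6)) — *"The formula (70) and the inequalities (71), (72) give finally the following inequality"*:**
for `‖A′‖ < ε₃`, under the printed smallness (norm-level form `18C₂B₀ε₃ ≤ 1`, `2ε₃ ≤ c₄`) and the inputs (44), (46), (72) on the radius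
2c₄, the solution D of (49) is Fréchet-differentiable at A′ (`B11Eq63FunctionalDerivative`: implicit function theorem, D continuous by
the contraction (54), C strictly differentiable as a C¹ map, `I + ℜ` invertible by (69) `‖ℜ‖ ≤ 9C₂B₀ε₃ ≤ ½`) and
`‖(δ/δA′)D(A′)‖ = ‖(I + ℜ)⁻¹𝒞′‖ ≤ 2 · C₃ · 2ε₃ = 4C₃ε₃` ((70); (71) ‖(I + ℜ)⁻¹‖ ≤ 2; (72) ‖𝒞′‖ ≤ C₃‖X₀‖ ≤ 2C₃ε₃ with ‖X₀‖ < 2ε₃ by (57)).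
[cite: Balaban1985Variational, (70)–(73) p.289] -/
theorem norm_fderiv_Dfix_le (hin : Inputs Ct hop C₂ C₃ B₀ c₄) (hC₂ : 0 ≤ C₂) (hC₃ : 0 ≤ C₃) (hB₀ : 0 ≤ B₀)
    (hε₃ : 0 < ε₃) (h18 : 18 * C₂ * B₀ * ε₃ ≤ 1) (h2 : 2 * ε₃ ≤ c₄) {A' : 𝒴} (hA' : ‖A'‖ < ε₃) :
    HasFDerivAt (Dfix Ct hop C₂) (fderiv ℂ (Dfix Ct hop C₂) A') A' ∧
      ‖fderiv ℂ (Dfix Ct hop C₂) A'‖ ≤ 4 * C₃ * ε₃ := by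
  have hc₄ : 0 < c₄ := by linarith
  obtain ⟨hq, hR2, hRC, hR⟩ := smallness hC₂ hB₀ hε₃.le le_rfl le_rfl hc₄ (by simpa using h18) h2
  have hQ : QuadAnalytic Ct C₂ (2 * c₄) := hin.quadAnalytic
  set D : 𝒴 → 𝒳 := Dfix Ct hop C₂ with hDdef
  have hDball := Dfix_ball (Ct := Ct) (hop := hop) hQ hC₂ hB₀ hin.norm_H hq hRC
  have hDfix := Dfix_fix (Ct := Ct) (hop := hop) hQ hC₂ hB₀ hin.norm_H hq hRC
  -- the ball ‖A″‖ < ε₃ is a neighbourhood of A′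
  have hball : ∀ᶠ A'' in 𝓝 A', ‖A''‖ < ε₃ := (isOpen_lt continuous_norm continuous_const).mem_nhds hA'
  -- (49) near A′, values in the ball, the contraction (54) near A′
  have h49 : ∀ᶠ A'' in 𝓝 A', D A'' = Ct (A'' - hin.hopL (D A'')) := by
    filter_upwards [hball] with A'' h using (hDfix A'' h).symm
  have hS : ∀ᶠ A'' in 𝓝 A', D A'' ∈ closedBall (0:𝒳) (4 * C₂ * ε₃ ^ 2) := by
    filter_upwards [hball] with A'' h using hDball A'' h
  have h54 : ∀ᶠ A'' in 𝓝 A', ∀ X ∈ closedBall (0:𝒳) (4 * C₂ * ε₃ ^ 2), ∀ X' ∈ closedBall (0:𝒳) (4 * C₂ * ε₃ ^ 2),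
      ‖Ct (A'' - hin.hopL X) - Ct (A'' - hin.hopL X')‖ ≤ 9 * C₂ * B₀ * ε₃ * ‖X - X'‖ := by
    filter_upwards [hball] with A'' h X hX X' hX'
    exact lipschitz_T hQ hC₂ hB₀ hin.norm_H h hR2 hRC hX hX'
  -- X₀ = A′ − HD(A′) has norm < 2ε₃ < 2c₄
  set X₀ : 𝒴 := A' - hin.hopL (D A') with hX₀def
  have hX₀ : ‖X₀‖ < 2 * ε₃ := by
    have h := B12Lineariz267.mapsTo_phi hQ hC₂ hB₀ hin.norm_H hq hRC hDball hDfix (mem_ball_zero_iff.mpr hA')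
    exact mem_ball_zero_iff.mp h
  have hX₀R : X₀ ∈ {Y : 𝒴 | ‖Y‖ < 2 * c₄} := show ‖X₀‖ < 2 * c₄ by linarith
  have hopen : IsOpen {Y : 𝒴 | ‖Y‖ < 2 * c₄} := isOpen_lt continuous_norm continuous_const
  have hCat : ContDiffAt ℂ 1 Ct X₀ := hin.contDiff.contDiffAt (hopen.mem_nhds hX₀R)
  set 𝒞' : 𝒴 →L[ℂ] 𝒳 := fderiv ℂ Ct X₀ with h𝒞'def
  have hstrict : HasStrictFDerivAt Ct 𝒞' X₀ := hCat.hasStrictFDerivAt one_ne_zero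
  -- continuity of D at A′ (p. 286, successive approximations / contraction)
  have hDc : ContinuousAt D A' :=
    B11Eq63FunctionalDerivative.continuousAt_of_eq49 hq h49 hS h54 hstrict.hasFDerivAt.continuousAt
  -- (69): ‖ℜ‖ ≤ 9C₂B₀ε₃ ≤ ½ < 1
  have hℜ : ‖𝒞' ∘L hin.hopL‖ ≤ 9 * C₂ * B₀ * ε₃ := opNorm_R_le hin hC₂ hB₀ hε₃ hR hX₀.le hstrict.hasFDerivAt
  have hℜ1 : ‖𝒞' ∘L hin.hopL‖ < 1 := by linarith
  -- (70): the derivative exists and equals (Σ(−ℜ)ⁿ)𝒞′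
  have h70 := B11Eq63FunctionalDerivative.eq70_neumann h49 hstrict hDc hℜ1
  have hfd : fderiv ℂ D A' = (∑' n : ℕ, (-(𝒞' ∘L hin.hopL)) ^ n) ∘L 𝒞' := h70.fderiv
  refine ⟨hfd ▸ h70, ?_⟩
  -- (71) at norm level and (72)
  have h71 : ‖∑' n : ℕ, (-(𝒞' ∘L hin.hopL)) ^ n‖ ≤ 2 := by
    refine (norm_neumann_le _ hℜ1).trans ?_
    rw [inv_le_comm₀ (by linarith) (by norm_num : (0:ℝ) < 2)]
    linarith
  have h72 : ‖𝒞'‖ ≤ C₃ * (2 * ε₃) :=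
    (hin.deriv_le X₀ hX₀R).trans (mul_le_mul_of_nonneg_left hX₀.le hC₃)
  rw [hfd]
  calc ‖(∑' n : ℕ, (-(𝒞' ∘L hin.hopL)) ^ n) ∘L 𝒞'‖
      ≤ ‖∑' n : ℕ, (-(𝒞' ∘L hin.hopL)) ^ n‖ * ‖𝒞'‖ := ContinuousLinearMap.opNorm_comp_le _ _
    _ ≤ 2 * (C₃ * (2 * ε₃)) := mul_le_mul h71 h72 (norm_nonneg _) (by norm_num)
    _ = 4 * C₃ * ε₃ := by ring

end NormLevel73

/-! ## §3 The model family -/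

/-- **A datum of the Sect. C scheme** over fixed carriers `𝒴` (configurations A′, norm of (43)), `𝒳` (values of D), `Cfg` (backgrounds
U₀): the scale data `L`, `dim` (= d ≥ 1) and the two background-dependent operators H(U₀) (`hop`) and A ↦ C_j(L^jηA) at U₀ (`Ct`) of
(44)–(47).  Their properties are NOT fields: they are the model's reading of the hypothesis (14) (`Inputs`, reading (M2)).
[cite: Balaban1985Variational, (44)–(47) p.285] -/
structure LinDatum (𝒴 𝒳 Cfg : Type) [NormedAddCommGroup 𝒴] [NormedSpace ℂ 𝒴] [NormedAddCommGroup 𝒳] [NormedSpace ℂ 𝒳] where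
  /-- the scale factor L -/
  L : ℝ
  /-- the dimension d -/
  dim : ℕ
  one_le_dim : 1 ≤ dim
  /-- H(U₀) of (45)–(46) -/
  hop : Cfg → (𝒳 →ₗ[ℂ] 𝒴)
  /-- A ↦ C_j(L^jηA) at the background U₀, (44) -/
  Ct : Cfg → 𝒴 → 𝒳

namespace LinDatum

variable {𝒴 𝒳 Cfg : Type} [NormedAddCommGroup 𝒴] [NormedSpace ℂ 𝒴] [NormedAddCommGroup 𝒳] [NormedSpace ℂ 𝒳]

/-- The model's D(A′) at the background U₀ (`Dfix` for the datum's C, H). [cite: Balaban1985Variational, (49) p.285] -/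
abbrev Dsol (D : LinDatum 𝒴 𝒳 Cfg) (C₂ : ℝ) (U₀ : Cfg) : 𝒴 → 𝒳 := Dfix (D.Ct U₀) (D.hop U₀) C₂

/-- **The `B11.LGData` carrier of a Sect. C datum** (readings (M1)–(M7)): `Fld := 𝒴`; `In43 U₀ ε A := ‖A‖ < ε`, `nM1 := ‖·‖`; `Sat14 _ _ _
U₀ := Inputs (Ct U₀) (hop U₀) C₂ C₃ B₀ c₄`; `T47 U₀ A′ := A′ − H(U₀)D(A′)` with D = `Dsol`; `Def47 U₀ ε` := (49) holds on ‖A′‖ < ε and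
A′ ↦ A′ − HD(A′) is holomorphic along complex lines there; `normD U₀ A′ := ‖D(A′)‖`; `kerD U₀ A′ _ _ := ‖(δ/δA′)D(A′)‖` (norm level, no
block geometry: `Cell = Site = PUnit`, `scale = 0`, `dist = 0`, `eta = 1`); every Sect. A–B / D–E field inert.
[cite: Balaban1985Variational, (43) p.285, (47)–(49) p.285, (55) p.286, (73) p.289] -/
def toLGData (D : LinDatum 𝒴 𝒳 Cfg) (Bdry : Type) (C₂ C₃ B₀ c₄ : ℝ) : B11.LGData where
  Cfg := Cfg
  Bdry := Bdry
  Pert := 𝒴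
  GT := PUnit
  Fld := 𝒴
  Cell := PUnit
  Site := PUnit
  L := D.L
  eta := 1
  dim := D.dim
  scale := fun _ => 0
  cscale := fun _ => 0
  dist := fun _ _ => 0
  Sat14 := fun _ _ _ U₀ => Inputs (D.Ct U₀) (D.hop U₀) C₂ C₃ B₀ c₄
  In18 := fun _ _ _ _ => True
  Crit := fun _ _ _ => True
  In19_21 := fun _ _ _ _ => True
  CritL := fun _ _ _ => True
  Restricted := fun _ _ => True
  toAxial := fun _ U₁ _ => U₁
  In43 := fun _ ε A => ‖A‖ < ε
  nM1 := fun _ A => ‖A‖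
  Def47 := fun U₀ ε =>
    (∀ A' : 𝒴, ‖A'‖ < ε → D.Ct U₀ (A' - D.hop U₀ (D.Dsol C₂ U₀ A')) = D.Dsol C₂ U₀ A') ∧
    ∀ P Q : 𝒴, DifferentiableOn ℂ (fun σ : ℂ => (P + σ • Q) - D.hop U₀ (D.Dsol C₂ U₀ (P + σ • Q)))
      {σ : ℂ | ‖P + σ • Q‖ < ε}
  T47 := fun U₀ A' => A' - D.hop U₀ (D.Dsol C₂ U₀ A')
  normD := fun U₀ A' => ‖D.Dsol C₂ U₀ A'‖
  kerD := fun U₀ A' _ _ => ‖fderiv ℂ (D.Dsol C₂ U₀) A'‖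
  nMax := fun _ A => ‖A‖
  dVn := fun _ _ => 0
  dVAnalytic := fun _ _ => True
  Sol111 := fun _ _ _ => True
  T112 := fun _ _ A₁ => A₁
  LikeH1B := fun _ _ _ => True
  Sol111G := fun _ _ _ => True
  SolAnalytic := fun _ _ _ => True

end LinDatum

/-! ## §4 Proposition 3 for the model family -/

section Family

variable {I : Type} (𝒴f 𝒳f Cfgf Bdryf : I → Type) [∀ i, NormedAddCommGroup (𝒴f i)] [∀ i, NormedSpace ℂ (𝒴f i)]
  [∀ i, CompleteSpace (𝒴f i)] [∀ i, NormedAddCommGroup (𝒳f i)] [∀ i, NormedSpace ℂ (𝒳f i)] [∀ i, CompleteSpace (𝒳f i)]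

/-- **Proposition 3 (p. 289) — the typed statement of record `B11.Prop3Printed C₁ B₃ C₂ C₃ B₀ c1h c₄ δ₀ fam` INHABITED BY NAME for the
model family** of Sect. C data `δ i` (carriers varying with the index; printed constants fixed, O(1) := 4 chosen before the index):
for 0 < ε₃ with «18C₂B₀dc₁(½)ε₃ ≤ 1, 2ε₃ ≤ c₄» and every background U₀ at which the inputs (44), (46), (72) hold — (i) the
transformation (47) is defined ((49) holds) and analytic (along complex lines) on (43)_{ε₃}; (ii) its range contains (43)_{ε₂} for
ε₂ ≤ ¼ε₃; (iii) it maps (43)_{ε₃} into (43)_{2ε₃}; (iv) (55) ‖D(A′)‖ ≤ 4C₂‖A′‖²; (v) (73) at norm level ‖(δ/δA′)D(A′)‖ ≤ 4C₃ε₃.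
Proof = the printed Sect. C argument as kernel-checked in `B13Contraction113`/`B12Lineariz267` ((49)–(62)) and
`B11Eq63FunctionalDerivative` ((63)–(70)), + §2.  Hypotheses on the constants: C₂, C₃, B₀ ≥ 0, c₄ > 0, c₁(½) ≥ 1 (reading (M4)).
The inputs [4] Props 4/5/7 and [5] Thm 3.12 are the model's (14) (NOT proved). [cite: Balaban1985Variational, Prop. 3 p.289] -/
theorem prop3Printed_model {C₁ B₃ C₂ C₃ B₀ c1h c₄ δ₀ : ℝ} (hC₂ : 0 ≤ C₂) (hC₃ : 0 ≤ C₃) (hB₀ : 0 ≤ B₀)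
    (hc₄ : 0 < c₄) (hc1h : 1 ≤ c1h) (δ : ∀ i, LinDatum (𝒴f i) (𝒳f i) (Cfgf i)) :
    B11.Prop3Printed C₁ B₃ C₂ C₃ B₀ c1h c₄ δ₀ (fun i => (δ i).toLGData (Bdryf i) C₂ C₃ B₀ c₄) := by
  refine ⟨4, by norm_num, ?_⟩
  intro i ε₁ ε₃ _ hε₃ h18 h2 V U₀ h14
  dsimp only [LinDatum.toLGData] at h14 h18 ⊢
  have hin : Inputs ((δ i).Ct U₀) ((δ i).hop U₀) C₂ C₃ B₀ c₄ := h14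
  have hd : (1 : ℝ) ≤ ((δ i).dim : ℝ) := by exact_mod_cast (δ i).one_le_dim
  obtain ⟨hq, hR2, hRC, hR⟩ := smallness hC₂ hB₀ hε₃.le hd hc1h hc₄ h18 h2
  have hQ : QuadAnalytic ((δ i).Ct U₀) C₂ (2 * c₄) := hin.quadAnalytic
  have hH := hin.norm_H
  have hDball := Dfix_ball (Ct := (δ i).Ct U₀) (hop := (δ i).hop U₀) hQ hC₂ hB₀ hH hq hRC
  have hDfix := Dfix_fix (Ct := (δ i).Ct U₀) (hop := (δ i).hop U₀) hQ hC₂ hB₀ hH hq hRC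
  refine ⟨⟨fun A' hA' => hDfix A' hA', fun P Q => ?_⟩, ?_, ?_, ?_, ?_⟩
  · -- (i) analyticity of A′ ↦ A′ − HD(A′) along the line P + σQ
    have hD := B12Lineariz267.differentiableOn_Dt_line hQ hC₂ hB₀ hH hq hRC hin.prop4Hyp.differentiableOn
      hDball hDfix P Q
    have hlin : DifferentiableOn ℂ (fun σ : ℂ => P + σ • Q) {σ : ℂ | ‖P + σ • Q‖ < ε₃} :=
      ((differentiable_id.smul_const Q).const_add P).differentiableOn
    have hcomp : DifferentiableOn ℂ (fun σ : ℂ => hin.hopL (Dfix ((δ i).Ct U₀) ((δ i).hop U₀) C₂ (P + σ • Q)))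
        {σ : ℂ | ‖P + σ • Q‖ < ε₃} := hin.hopL.differentiable.comp_differentiableOn hD
    exact hlin.sub hcomp
  · -- (ii) the range contains (43) with ε₂ ≤ ε₃/4: A = Φ(A + HC(A))
    intro ε₂ hε₂ A hA
    have hA2 : ‖A‖ < ε₃ / 2 := by linarith
    obtain ⟨hΨ, hΦΨ⟩ := B12Lineariz267.phi_psi_of_norm_lt hQ hC₂ hB₀ hH hq hRC hDball hDfix hA2
    exact ⟨A + (δ i).hop U₀ ((δ i).Ct U₀ A), hΨ, hΦΨ⟩
  · -- (iii) the range is contained in (43) with 2ε₃: (57)–(58)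
    intro A' hA'
    have h := B12Lineariz267.mapsTo_phi hQ hC₂ hB₀ hH hq hRC hDball hDfix (mem_ball_zero_iff.mpr hA')
    exact mem_ball_zero_iff.mp h
  · -- (iv) (55)
    intro A' hA'
    exact (Dfix_spec hQ hC₂ hB₀ hH hq hRC hA').1
  · -- (v) (73) at norm level
    intro A' _ _ hA'
    have h18' : 18 * C₂ * B₀ * ε₃ ≤ 1 := by
      have hdc : 1 ≤ ((δ i).dim : ℝ) * c1h := by nlinarith
      have h0 : 0 ≤ 18 * C₂ * B₀ * ε₃ := by positivity
      have : 18 * C₂ * B₀ * ε₃ * 1 ≤ 18 * C₂ * B₀ * ε₃ * (((δ i).dim : ℝ) * c1h) :=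
        mul_le_mul_of_nonneg_left hdc h0
      nlinarith
    have h73 := (norm_fderiv_Dfix_le hin hC₂ hC₃ hB₀ hε₃ h18' h2 hA').2
    have hscale : ((δ i).L ^ (0:ℕ) * (1:ℝ)) ^ (1 - ((δ i).dim : ℝ)) = 1 := by simp
    have hexp : Real.exp (-(δ₀ / 2) * 0) = 1 := by simp
    rw [hscale, hexp, mul_one, mul_one]
    simpa [mul_comm, mul_left_comm, mul_assoc] using h73

end Family

end Literature.MathematicalPhysics.QuantumFieldTheory.Balaban1983to89.B11Prop3Model

end
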